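import Summits.CriticalPhenomena.PercolationContinuityZ3.Theorems.PercNearOneGluingNoHeavyLowerTailAPLSeriesReduction
import Summits.CriticalPhenomena.PercolationContinuityZ3.Theorems.PercNearOneGluingNoHeavyLowerTailAPLPendantCells
import Summits.CriticalPhenomena.PercolationContinuityZ3.Theorems.PercNearOneGluingNoHeavyLowerTailAPLCellsBasic
import HarnessLib

/-!
# `NoHeavyLowerTail` (stmt-CriticalPhenomena-4575) — THE BEAD-CHAIN (UNIQUE-PATH) THEOREM: `E ≤ 1` whenever the ports are joined by a string of beads;
# `(P(o↔u, o↔v) − P(o↔u)P(o↔v))² ≤ P(o↔u)·P(o↔v)·P(u↔v, o↮u)` for bond percolation with arbitrary weights (fans, combs, apex-over-trees, bead chains)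

Support file (prover prim-ineq-gen-8 gen 58; `--supports stmt-CriticalPhenomena-4575`; memo
run/shared/lean/prim/prim-ineq-gen-8/FINDING-gen58-SERIES-LEAN.md §0(1), §2; pencil version memo gen 57 FINDING-gen57-EROUTE.md §0(7)).
No definitions, no named facts, no sorries.

SETTING.  An apex `o`, string vertices `y 0, …, y n` (pairwise distinct, `≠ o`) joined consecutively by the string edges `s(y k, y (k+1))`,
and BEADS `S 0, …, S n : Finset (Sym2 V)` — arbitrary edge sets (blobs of any shape, with or without apex edges; `S k` is "hung at `y k`"):
pairwise disjoint, two different beads share no vertex other than the apex `o`, and the string vertex `y j` meets no bead other than `S j`.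
Edge set `B n = ⋃_{k ≤ n} S k ∪ {s(y k, y (k+1)) : k < n}`, ports `u = y 0`, `v = y n`, arbitrary weights in `[0,1]` (weight `0` = absent).  This
is the class "`u` and `v` are joined by a UNIQUE simple path in `G ∖ o`" of memo gen 57 §0(7) (beads = the components of `G ∖ o` minus the string
edges, together with their apex edges): fans `o ∗ P_n` (`S k = {s(o, y k)}`), combs, apex-over-tree graphs, bead chains of 2-connected blobs — the
family on which the lineage's three-point member `a = 2` ((PV) diagonal, Conjecture (★★₂) `κ² ≤ 2·pπ·m`) is asymptotically extremal (gen 55).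
THEOREM (gen 57 pencil, gen 58 kernel): **`E := κ²/(pπ·m) ≤ 1`** on the whole class — STRONGER there than (★★₂), sharp as weights degenerate.
PROOF: induction along the string with the series reduction theorem `series_reduction` (`…APLSeriesReduction.lean`, `C = 1`):
`B (n+1) = B n ∪ (S (n+1) ∪ {s(y n, y (n+1))})` is a gluing at the cut vertex `y n`, and the new piece is the bead `S (n+1)` hung (`hang_E`) at the
port `y (n+1)` of the apex-free string edge (`apexFree_E`); the base is `selfPort_E`.
* `selfPort_m`, **`selfPort_E`** — `E = 1 − P(o↔y) ≤ 1` (indeed `≤ C` for `C ≥ 1`) for ANY edge set with both ports at one vertex `y` (a bead alone).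
* `apexFree_p`, `apexFree_E` — an edge set avoiding the apex has `p = κ = 0`.
* **`hang_E`** — BEADS ARE FREE: `E ≤ C` (`C ≥ 1`) is preserved when an arbitrary edge set (apex edges allowed) is hung at a port.
* `bead_mem_vertex`, `bead_succ` — bookkeeping of `B n`.
* **`beadChain_E_le_one`** (`PrW` form) and **`beadChain_E_le_one_prodBernoulli`**: for `μ = prodBernoulli w` on the pairs of a finite vertex type,
  if every positive-weight pair is a string edge or lies in a bead, then with `u = y 0`, `v = y n`:
  `(μ(o↔u ∩ o↔v) − μ(o↔u)μ(o↔v))² ≤ μ(o↔u)·μ(o↔v)·μ((o↔u)ᶜ ∩ u↔v)`.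
[this work]
-/

namespace Summit.CriticalPhenomena.PercolationContinuityZ3.Theorems

namespace APL

open Literature.Probability.Percolation Literature.Probability.Percolation.Gladkov Literature.Probability.Percolation.DecisionTree
open scoped Classical

variable {V : Type*} [Fintype V]

section Dec

variable [DecidableEq V]

/-! ### The pieces: a bead alone, an apex-free edge set, hanging a bead at a port -/

section Pieces

variable (p : Sym2 V → ℝ)

/-- Self-port bookkeeping: `P(y ∉ cl o ∧ y ∈ cl y) = 1 − P(y ∈ cl o)`. [folklore] -/
theorem selfPort_m (S : Finset (Sym2 V)) (o y : V) :
    PrW S p {K : Finset (Sym2 V) | y ∉ cl K o ∧ y ∈ cl K y} = 1 - PrW S p {K : Finset (Sym2 V) | y ∈ cl K o} := by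
  have hdisj : Disjoint {K : Finset (Sym2 V) | y ∈ cl K o} {K : Finset (Sym2 V) | y ∉ cl K o ∧ y ∈ cl K y} :=
    Set.disjoint_left.2 fun K hK hK' => hK'.1 hK
  have hun : {K : Finset (Sym2 V) | y ∈ cl K o} ∪ {K : Finset (Sym2 V) | y ∉ cl K o ∧ y ∈ cl K y} = Set.univ := by
    ext K
    simp only [Set.mem_union, Set.mem_setOf_eq, Set.mem_univ, iff_true]
    by_cases h : y ∈ cl K o
    · exact Or.inl h
    · exact Or.inr ⟨h, mem_cl_self _ _⟩
  have h := PrW_union S p hdisj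
  rw [hun, PrW_univ] at h
  linarith

/-- **`E ≤ C` (`C ≥ 1`) for ANY edge set with the degenerate ports `u = c = y`** ("a bead hung at `y`", e.g. a single apex edge `s(o,y)`):
with `a = P(y ∈ cl o)` the instance `(o; y, y)` has `p = π = τ = a`, `m = 1 − a`, and `(a − a²)² ≤ C·a·a·(1 − a)` (`E = 1 − a`). [this work] -/
theorem selfPort_E (hp0 : ∀ e, 0 ≤ p e) (hp1 : ∀ e, p e ≤ 1) (S : Finset (Sym2 V)) (o y : V) (C : ℝ) (hC : 1 ≤ C) :
    (PrW S p {K : Finset (Sym2 V) | y ∈ cl K o ∧ y ∈ cl K o}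
        - PrW S p {K : Finset (Sym2 V) | y ∈ cl K o} * PrW S p {K : Finset (Sym2 V) | y ∈ cl K o}) ^ 2
      ≤ C * PrW S p {K : Finset (Sym2 V) | y ∈ cl K o} * PrW S p {K : Finset (Sym2 V) | y ∈ cl K o}
        * PrW S p {K : Finset (Sym2 V) | y ∉ cl K o ∧ y ∈ cl K y} := by
  have hτ : {K : Finset (Sym2 V) | y ∈ cl K o ∧ y ∈ cl K o} = {K : Finset (Sym2 V) | y ∈ cl K o} := by
    ext K; simp only [Set.mem_setOf_eq, and_self]
  rw [hτ, selfPort_m p S o y]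
  set a := PrW S p {K : Finset (Sym2 V) | y ∈ cl K o} with ha
  have h0 : 0 ≤ a := PrW_nonneg S hp0 hp1 _
  have h1 : a ≤ 1 := PrW_cl_le_one S hp0 hp1 _
  have e : (a - a * a) ^ 2 = (a * a * (1 - a)) * (1 - a) := by ring
  have hX : 0 ≤ a * a * (1 - a) := mul_nonneg (mul_nonneg h0 h0) (sub_nonneg.2 h1)
  rw [e]
  calc a * a * (1 - a) * (1 - a) ≤ a * a * (1 - a) * 1 := mul_le_mul_of_nonneg_left (by linarith) hX
    _ ≤ a * a * (1 - a) * C := mul_le_mul_of_nonneg_left hC hX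
    _ = C * a * a * (1 - a) := by ring

/-- An apex-free edge set: `P(a ∈ cl o) = 0` for `a ≠ o`. [folklore] -/
theorem apexFree_p (D : Finset (Sym2 V)) {o a : V} (hD : ∀ e ∈ D, o ∉ e) (hao : a ≠ o) :
    PrW D p {K : Finset (Sym2 V) | a ∈ cl K o} = 0 :=
  PrW_eq_zero_of_forall_not_mem D p fun _ hL hmem =>
    pendant_not_mem_cl (fun f hf => hD f (hL hf)) hao hmem

/-- **`E ≤ C` for an apex-free piece** (both sides vanish: `κ = p = 0`). [folklore] -/
theorem apexFree_E (D : Finset (Sym2 V)) {o a b : V} (hD : ∀ e ∈ D, o ∉ e) (hao : a ≠ o) (C : ℝ) :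
    (PrW D p {K : Finset (Sym2 V) | a ∈ cl K o ∧ b ∈ cl K o}
        - PrW D p {K : Finset (Sym2 V) | a ∈ cl K o} * PrW D p {K : Finset (Sym2 V) | b ∈ cl K o}) ^ 2
      ≤ C * PrW D p {K : Finset (Sym2 V) | a ∈ cl K o} * PrW D p {K : Finset (Sym2 V) | b ∈ cl K o}
        * PrW D p {K : Finset (Sym2 V) | a ∉ cl K o ∧ b ∈ cl K a} := by
  have h0 : PrW D p {K : Finset (Sym2 V) | a ∈ cl K o ∧ b ∈ cl K o} = 0 :=
    PrW_eq_zero_of_forall_not_mem D p fun _ hL hmem =>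
      pendant_not_mem_cl (fun f hf => hD f (hL hf)) hao hmem.1
  rw [h0, apexFree_p p D hD hao]
  simp

/-- **BEADS ARE FREE** (`E ≤ C` is preserved under hanging an arbitrary edge set at a port): if `S` (the bead, which may contain apex
edges) and `D` are disjoint, every vertex meeting both is `o` or `c`, the port `v` of `D` meets `S` only if `v = c`, `c, v ≠ o`, `c ≠ v`,
`C ≥ 1` and `E(D; o; v, c) ≤ C`, then `E(S ∪ D; o; c, v) ≤ C` — the series gluing of the self-port piece `(S; o; c, c)` (`selfPort_E`)
with `D`. [this work] -/
theorem hang_E (hp0 : ∀ e, 0 ≤ p e) (hp1 : ∀ e, p e ≤ 1) (S D : Finset (Sym2 V)) (hdisj : Disjoint S D) (o c v : V)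
    (hsep : ∀ y : V, (∃ e ∈ S, y ∈ e) → (∃ e ∈ D, y ∈ e) → (y = o ∨ y = c))
    (hv : ∀ e ∈ S, v ∈ e → v = c) (hco : c ≠ o) (hvo : v ≠ o) (hcv : c ≠ v) (C : ℝ) (hC : 1 ≤ C)
    (hE : (PrW D p {K : Finset (Sym2 V) | v ∈ cl K o ∧ c ∈ cl K o}
        - PrW D p {K : Finset (Sym2 V) | v ∈ cl K o} * PrW D p {K : Finset (Sym2 V) | c ∈ cl K o}) ^ 2
        ≤ C * PrW D p {K : Finset (Sym2 V) | v ∈ cl K o} * PrW D p {K : Finset (Sym2 V) | c ∈ cl K o}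
          * PrW D p {K : Finset (Sym2 V) | v ∉ cl K o ∧ c ∈ cl K v}) :
    (PrW (S ∪ D) p {K : Finset (Sym2 V) | c ∈ cl K o ∧ v ∈ cl K o}
        - PrW (S ∪ D) p {K : Finset (Sym2 V) | c ∈ cl K o} * PrW (S ∪ D) p {K : Finset (Sym2 V) | v ∈ cl K o}) ^ 2
      ≤ C * PrW (S ∪ D) p {K : Finset (Sym2 V) | c ∈ cl K o} * PrW (S ∪ D) p {K : Finset (Sym2 V) | v ∈ cl K o}
        * PrW (S ∪ D) p {K : Finset (Sym2 V) | c ∉ cl K o ∧ v ∈ cl K c} :=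
  series_reduction p hp0 hp1 S D hdisj o c c v hsep (fun _ _ _ => rfl) hv hco hvo hcv C hC (selfPort_E p hp0 hp1 S o c C hC) hE

end Pieces

/-! ### The bead chain -/

section Chain

variable (o : V) (y : ℕ → V) (S : ℕ → Finset (Sym2 V))

omit [Fintype V] in
/-- A vertex of `B n` meets a bead `S i`, `i ≤ n`, or is a string vertex `y k`, `k ≤ n`. [folklore] -/
theorem bead_mem_vertex (n : ℕ) {e : Sym2 V}
    (he : e ∈ (Finset.range (n + 1)).biUnion S ∪ (Finset.range n).image (fun k => s(y k, y (k + 1))))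
    {z : V} (hz : z ∈ e) : (∃ i, i ≤ n ∧ ∃ f ∈ S i, z ∈ f) ∨ ∃ k, k ≤ n ∧ z = y k := by
  rw [Finset.mem_union, Finset.mem_biUnion, Finset.mem_image] at he
  rcases he with ⟨i, hi, heS⟩ | ⟨k, hk, rfl⟩
  · rw [Finset.mem_range] at hi
    exact Or.inl ⟨i, by omega, e, heS, hz⟩
  · rw [Finset.mem_range] at hk
    rcases Sym2.mem_iff.1 hz with rfl | rfl
    · exact Or.inr ⟨k, by omega, rfl⟩
    · exact Or.inr ⟨k + 1, by omega, rfl⟩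

omit [Fintype V] in
/-- `B (n+1) = B n ∪ (S (n+1) ∪ {s(y n, y (n+1))})`. [folklore] -/
theorem bead_succ (n : ℕ) :
    (Finset.range (n + 1 + 1)).biUnion S ∪ (Finset.range (n + 1)).image (fun k => s(y k, y (k + 1)))
      = ((Finset.range (n + 1)).biUnion S ∪ (Finset.range n).image (fun k => s(y k, y (k + 1))))
        ∪ (S (n + 1) ∪ {s(y n, y (n + 1))}) := by
  ext e
  simp only [Finset.mem_union, Finset.mem_biUnion, Finset.mem_image, Finset.mem_range, Finset.mem_singleton]
  constructor
  · rintro (⟨i, hi, he⟩ | ⟨k, hk, rfl⟩)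
    · rcases Nat.lt_or_ge i (n + 1) with hi' | hi'
      · exact Or.inl (Or.inl ⟨i, hi', he⟩)
      · obtain rfl : i = n + 1 := by omega
        exact Or.inr (Or.inl he)
    · rcases Nat.lt_or_ge k n with hk' | hk'
      · exact Or.inl (Or.inr ⟨k, hk', rfl⟩)
      · obtain rfl : k = n := by omega
        exact Or.inr (Or.inr rfl)
  · rintro ((⟨i, hi, he⟩ | ⟨k, hk, rfl⟩) | (he | rfl))
    · exact Or.inl ⟨i, by omega, he⟩
    · exact Or.inr ⟨k, by omega, rfl⟩
    · exact Or.inl ⟨n + 1, by omega, he⟩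
    · exact Or.inr ⟨n, by omega, rfl⟩

/-- **THE BEAD-CHAIN THEOREM (`PrW` form).**  Weights `p ∈ [0,1]`; apex `o`; string vertices `y 0, …, y n` pairwise distinct and `≠ o`;
beads `S 0, …, S n` pairwise disjoint, sharing no vertex except `o`, and `y j` meeting no bead `S i` with `i ≠ j`.  Then on
`B n = ⋃_{k ≤ n} S k ∪ {s(y k, y (k+1)) : k < n}` with ports `u = y 0`, `v = y n`:
`(P(o↔u, o↔v) − P(o↔u)P(o↔v))² ≤ 1·P(o↔u)·P(o↔v)·P(o↮u, u↔v)` (`E ≤ 1`). [this work] -/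
theorem beadChain_E_le_one (p : Sym2 V → ℝ) (hp0 : ∀ e, 0 ≤ p e) (hp1 : ∀ e, p e ≤ 1) (n : ℕ)
    (hy : ∀ i j, i ≤ n → j ≤ n → y i = y j → i = j) (hyo : ∀ i, i ≤ n → y i ≠ o)
    (hSS : ∀ i j, i ≤ n → j ≤ n → i ≠ j → Disjoint (S i) (S j))
    (hSo : ∀ i j, i ≤ n → j ≤ n → i ≠ j → ∀ z : V, (∃ e ∈ S i, z ∈ e) → (∃ e ∈ S j, z ∈ e) → z = o)
    (hSy : ∀ i j, i ≤ n → j ≤ n → (∃ e ∈ S i, y j ∈ e) → i = j) :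
    (PrW ((Finset.range (n + 1)).biUnion S ∪ (Finset.range n).image (fun k => s(y k, y (k + 1)))) p
          {K : Finset (Sym2 V) | y 0 ∈ cl K o ∧ y n ∈ cl K o}
        - PrW ((Finset.range (n + 1)).biUnion S ∪ (Finset.range n).image (fun k => s(y k, y (k + 1)))) p
            {K : Finset (Sym2 V) | y 0 ∈ cl K o}
          * PrW ((Finset.range (n + 1)).biUnion S ∪ (Finset.range n).image (fun k => s(y k, y (k + 1)))) p
            {K : Finset (Sym2 V) | y n ∈ cl K o}) ^ 2
      ≤ 1 * PrW ((Finset.range (n + 1)).biUnion S ∪ (Finset.range n).image (fun k => s(y k, y (k + 1)))) p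
            {K : Finset (Sym2 V) | y 0 ∈ cl K o}
        * PrW ((Finset.range (n + 1)).biUnion S ∪ (Finset.range n).image (fun k => s(y k, y (k + 1)))) p
            {K : Finset (Sym2 V) | y n ∈ cl K o}
        * PrW ((Finset.range (n + 1)).biUnion S ∪ (Finset.range n).image (fun k => s(y k, y (k + 1)))) p
            {K : Finset (Sym2 V) | y 0 ∉ cl K o ∧ y n ∈ cl K (y 0)} := by
  induction n with
  | zero =>
    have hB : (Finset.range (0 + 1)).biUnion S ∪ (Finset.range 0).image (fun k => s(y k, y (k + 1))) = S 0 := by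
      simp
    rw [hB]
    exact selfPort_E p hp0 hp1 _ o (y 0) 1 le_rfl
  | succ n ih =>
    have ih' := ih (fun i j hi hj h => hy i j (by omega) (by omega) h) (fun i hi => hyo i (by omega))
      (fun i j hi hj hij => hSS i j (by omega) (by omega) hij) (fun i j hi hj hij => hSo i j (by omega) (by omega) hij)
      (fun i j hi hj h => hSy i j (by omega) (by omega) h)
    rw [bead_succ y S n]
    -- distinctness facts
    have hy1o : y (n + 1) ≠ o := hyo (n + 1) le_rfl
    have hyno : y n ≠ o := hyo n (by omega)
    have hy0o : y 0 ≠ o := hyo 0 (by omega)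
    have hyn1 : y n ≠ y (n + 1) := fun h => by have := hy n (n + 1) (by omega) le_rfl h; omega
    have hy01 : y 0 ≠ y (n + 1) := fun h => by have := hy 0 (n + 1) (by omega) le_rfl h; omega
    -- string vertices `y k`, `k ≤ n`, do not meet the new bead; the new string vertex does not meet `B n`
    have hyS : ∀ k, k ≤ n → ∀ e ∈ S (n + 1), y k ∉ e := fun k hk e he hmem => by
      have := hSy (n + 1) k le_rfl (by omega) ⟨e, he, hmem⟩; omega
    have hnew : ∀ e ∈ (Finset.range (n + 1)).biUnion S ∪ (Finset.range n).image (fun k => s(y k, y (k + 1))),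
        y (n + 1) ∉ e := by
      intro e he hmem
      rcases bead_mem_vertex y S n he hmem with ⟨i, hi, f, hf, hyf⟩ | ⟨k, hk, h⟩
      · have := hSy i (n + 1) (by omega) le_rfl ⟨f, hf, hyf⟩; omega
      · have := hy (n + 1) k le_rfl (by omega) h; omega
    -- a vertex of the new bead meeting `B n` is the apex
    have hbead : ∀ z : V, (∃ e ∈ S (n + 1), z ∈ e) →
        (∃ e ∈ (Finset.range (n + 1)).biUnion S ∪ (Finset.range n).image (fun k => s(y k, y (k + 1))), z ∈ e) → z = o := by
      rintro z hzS ⟨e, he, hze⟩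
      rcases bead_mem_vertex y S n he hze with ⟨i, hi, f, hf, hzf⟩ | ⟨k, hk, rfl⟩
      · exact hSo (n + 1) i le_rfl (by omega) (by omega) z hzS ⟨f, hf, hzf⟩
      · obtain ⟨f, hf, hyf⟩ := hzS
        exact absurd hyf (hyS k hk f hf)
    have hdisj : Disjoint ((Finset.range (n + 1)).biUnion S ∪ (Finset.range n).image (fun k => s(y k, y (k + 1))))
        (S (n + 1) ∪ {s(y n, y (n + 1))}) := by
      refine Finset.disjoint_left.2 fun e he1 he2 => ?_
      rw [Finset.mem_union, Finset.mem_singleton] at he2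
      rcases he2 with he2 | rfl
      · -- an edge of the new bead lying in `B n`: both of its endpoints are `o`, yet beads are disjoint / string edges are not loops at `o`
        rw [Finset.mem_union, Finset.mem_biUnion, Finset.mem_image] at he1
        rcases he1 with ⟨i, hi, heS⟩ | ⟨k, hk, rfl⟩
        · rw [Finset.mem_range] at hi
          exact Finset.disjoint_left.1 (hSS i (n + 1) (by omega) le_rfl (by omega)) heS he2
        · rw [Finset.mem_range] at hk
          exact hyS k (by omega) _ he2 (Sym2.mem_mk_left _ _)
      · exact hnew _ he1 (Sym2.mem_mk_right _ _)
    have hsep : ∀ z : V,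
        (∃ e ∈ (Finset.range (n + 1)).biUnion S ∪ (Finset.range n).image (fun k => s(y k, y (k + 1))), z ∈ e) →
        (∃ e ∈ S (n + 1) ∪ {s(y n, y (n + 1))}, z ∈ e) → (z = o ∨ z = y n) := by
      rintro z hzB ⟨f, hf, hzf⟩
      rw [Finset.mem_union, Finset.mem_singleton] at hf
      rcases hf with hf | rfl
      · exact Or.inl (hbead z ⟨f, hf, hzf⟩ hzB)
      · rcases Sym2.mem_iff.1 hzf with h | h
        · exact Or.inr h
        · obtain ⟨e, he, hze⟩ := hzB
          exact absurd hze (h ▸ hnew e he)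
    have hu : ∀ e ∈ S (n + 1) ∪ {s(y n, y (n + 1))}, y 0 ∈ e → y 0 = y n := by
      intro e he h0
      rw [Finset.mem_union, Finset.mem_singleton] at he
      rcases he with he | rfl
      · exact absurd h0 (hyS 0 (by omega) e he)
      · rcases Sym2.mem_iff.1 h0 with h | h
        · exact h
        · exact absurd h hy01
    have hv : ∀ e ∈ (Finset.range (n + 1)).biUnion S ∪ (Finset.range n).image (fun k => s(y k, y (k + 1))),
        y (n + 1) ∈ e → y (n + 1) = y n := fun e he h => absurd h (hnew e he)
    -- the new piece: the bead `S (n+1)` hung at the port `y (n+1)` of the string edge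
    have hdisj2 : Disjoint (S (n + 1)) {s(y n, y (n + 1))} :=
      Finset.disjoint_singleton_right.2 fun h => hyS n le_rfl _ h (Sym2.mem_mk_left _ _)
    have hsep2 : ∀ z : V, (∃ e ∈ S (n + 1), z ∈ e) → (∃ e ∈ ({s(y n, y (n + 1))} : Finset (Sym2 V)), z ∈ e) →
        (z = o ∨ z = y (n + 1)) := by
      rintro z ⟨e, he, hze⟩ ⟨f, hf, hzf⟩
      rw [Finset.mem_singleton] at hf
      subst hf
      rcases Sym2.mem_iff.1 hzf with rfl | h
      · exact absurd hze (hyS n le_rfl e he)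
      · exact Or.inr h
    have hv2 : ∀ e ∈ S (n + 1), y n ∈ e → y n = y (n + 1) := fun e he h => absurd h (hyS n le_rfl e he)
    have hpiece := hang_E p hp0 hp1 (S (n + 1)) {s(y n, y (n + 1))} hdisj2 o (y (n + 1)) (y n) hsep2 hv2 hy1o hyno hyn1.symm
      1 le_rfl (apexFree_E p {s(y n, y (n + 1))} (fun e he => by
        rw [Finset.mem_singleton] at he; subst he
        intro h; rcases Sym2.mem_iff.1 h with h | h
        · exact hyno h.symm
        · exact hy1o h.symm) hyno 1)
    exact series_reduction p hp0 hp1 _ _ hdisj o (y n) (y 0) (y (n + 1)) hsep hu hv hy0o hy1o hy01 1 le_rfl ih' hpiece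

end Chain

end Dec

/-! ### The bead-chain theorem for `prodBernoulli` -/

/-- **THE BEAD-CHAIN (UNIQUE-PATH) THEOREM for bond percolation** (`μ = prodBernoulli w` on the pairs of a finite vertex type; memo gen 57
§0(7), kernel gen 58).  Apex `o`; string `y 0 — y 1 — ⋯ — y n` (pairwise distinct, `≠ o`); beads `S 0, …, S n` (pairwise disjoint edge sets,
two beads share no vertex but `o`, `y j` meets only the bead `S j`); every pair of positive weight is a string edge or lies in a bead.
Then with `u = y 0`, `v = y n`: `(μ(o↔u ∩ o↔v) − μ(o↔u)·μ(o↔v))² ≤ μ(o↔u)·μ(o↔v)·μ((o↔u)ᶜ ∩ u↔v)` — `E ≤ 1` (Conjecture (★★₂)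
asks only `≤ 2`). [this work] -/
theorem beadChain_E_le_one_prodBernoulli (w : Sym2 V → unitInterval) (o : V) (y : ℕ → V) (S : ℕ → Finset (Sym2 V)) (n : ℕ)
    (hy : ∀ i j, i ≤ n → j ≤ n → y i = y j → i = j) (hyo : ∀ i, i ≤ n → y i ≠ o)
    (hSS : ∀ i j, i ≤ n → j ≤ n → i ≠ j → Disjoint (S i) (S j))
    (hSo : ∀ i j, i ≤ n → j ≤ n → i ≠ j → ∀ z : V, (∃ e ∈ S i, z ∈ e) → (∃ e ∈ S j, z ∈ e) → z = o)
    (hSy : ∀ i j, i ≤ n → j ≤ n → (∃ e ∈ S i, y j ∈ e) → i = j)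
    (hw : ∀ e : Sym2 V, 0 < (w e : ℝ) →
      e ∈ (Finset.range (n + 1)).biUnion S ∪ (Finset.range n).image (fun k => s(y k, y (k + 1)))) :
    ((Literature.Probability.LatticeModels.prodBernoulli w).real
          ((openConn o (y 0) : Set (BondConfig V)) ∩ (openConn o (y n) : Set (BondConfig V)))
        - (Literature.Probability.LatticeModels.prodBernoulli w).real (openConn o (y 0) : Set (BondConfig V))
          * (Literature.Probability.LatticeModels.prodBernoulli w).real (openConn o (y n) : Set (BondConfig V))) ^ 2
      ≤ (Literature.Probability.LatticeModels.prodBernoulli w).real (openConn o (y 0) : Set (BondConfig V))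
        * (Literature.Probability.LatticeModels.prodBernoulli w).real (openConn o (y n) : Set (BondConfig V))
        * (Literature.Probability.LatticeModels.prodBernoulli w).real
          ((openConn o (y 0) : Set (BondConfig V))ᶜ ∩ (openConn (y 0) (y n) : Set (BondConfig V))) := by
  have hcl : ∀ (T : Finset (Sym2 V)) (a b : V), (↑T : Set (Sym2 V)) ∈ openConn a b ↔ b ∈ cl T a :=
    fun T a b => by rw [mem_cl]; rfl
  set F := (Finset.range (n + 1)).biUnion S ∪ (Finset.range n).image (fun k => s(y k, y (k + 1))) with hFdef
  have hp0 : ∀ e, 0 ≤ (fun e => (w e : ℝ)) e := fun e => (w e).2.1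
  have hp1 : ∀ e, (fun e => (w e : ℝ)) e ≤ 1 := fun e => (w e).2.2
  have hsupp : ∀ X : Set (Finset (Sym2 V)), PrW Finset.univ (fun e => (w e : ℝ)) X = PrW F (fun e => (w e : ℝ)) X :=
    fun X => PrW_of_support (fun e => (w e : ℝ)) (Finset.subset_univ F) (fun e _ heF => by
      by_contra hne
      exact heF (hw e (lt_of_le_of_ne (w e).2.1 (Ne.symm hne)))) X
  have cτ : (Literature.Probability.LatticeModels.prodBernoulli w).real
      ((openConn o (y 0) : Set (BondConfig V)) ∩ (openConn o (y n) : Set (BondConfig V)))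
      = PrW F (fun e => (w e : ℝ)) {K : Finset (Sym2 V) | y 0 ∈ cl K o ∧ y n ∈ cl K o} := by
    rw [prodBernoulli_real_eq_PrW_univ w (X := {K : Finset (Sym2 V) | y 0 ∈ cl K o ∧ y n ∈ cl K o}) fun T => by
      simp only [Set.mem_setOf_eq, Set.mem_inter_iff, hcl], hsupp]
  have cp : (Literature.Probability.LatticeModels.prodBernoulli w).real (openConn o (y 0) : Set (BondConfig V))
      = PrW F (fun e => (w e : ℝ)) {K : Finset (Sym2 V) | y 0 ∈ cl K o} := by
    rw [prodBernoulli_real_eq_PrW_univ w (X := {K : Finset (Sym2 V) | y 0 ∈ cl K o}) fun T => by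
      simp only [Set.mem_setOf_eq, hcl], hsupp]
  have cπ : (Literature.Probability.LatticeModels.prodBernoulli w).real (openConn o (y n) : Set (BondConfig V))
      = PrW F (fun e => (w e : ℝ)) {K : Finset (Sym2 V) | y n ∈ cl K o} := by
    rw [prodBernoulli_real_eq_PrW_univ w (X := {K : Finset (Sym2 V) | y n ∈ cl K o}) fun T => by
      simp only [Set.mem_setOf_eq, hcl], hsupp]
  have cm : (Literature.Probability.LatticeModels.prodBernoulli w).real
      ((openConn o (y 0) : Set (BondConfig V))ᶜ ∩ (openConn (y 0) (y n) : Set (BondConfig V)))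
      = PrW F (fun e => (w e : ℝ)) {K : Finset (Sym2 V) | y 0 ∉ cl K o ∧ y n ∈ cl K (y 0)} := by
    rw [prodBernoulli_real_eq_PrW_univ w (X := {K : Finset (Sym2 V) | y 0 ∉ cl K o ∧ y n ∈ cl K (y 0)}) fun T => by
      simp only [Set.mem_setOf_eq, Set.mem_inter_iff, Set.mem_compl_iff, hcl], hsupp]
  rw [cτ, cp, cπ, cm]
  have h := beadChain_E_le_one o y S (fun e => (w e : ℝ)) hp0 hp1 n hy hyo hSS hSo hSy
  rw [one_mul] at h
  exact h

end APL

end Summit.CriticalPhenomena.PercolationContinuityZ3.Theorems
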